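import Summits.CriticalPhenomena.CardyFormulaZ2.Theorems.CardyFlipRussoCoveringLegDefs
import Summits.CriticalPhenomena.CardyFormulaZ2.Theorems.CardyFlipRussoCoveringLegStubCoveringBridgeSandwich
import Summits.CriticalPhenomena.CardyFormulaZ2.Theorems.CardyIKTransportCornerLineDescentFreezeContinuity
import HarnessLib

/-!
# The lower inclusion of `stub_coveringBridgeShift` (line `five-arm-null` v3, crux `CardyFlipRusso.CoveringLeg`)

Helper file `--supports stmt-CriticalPhenomena-6435` (registered helper stub
`cover_lowerCrossing_subset_crossS_shift` of the skeleton stub `stub_coveringBridgeShift`, skeleton v3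
"shifted family", lead `prover-line-stmt-CriticalPhenomena-6435-c1-0`).

THE STATEMENT (deterministic, no probability).  For a lattice configuration `η ⊆ E(ℤ²)` in the thinned
collar-to-collar bond event `Freeze.lowerCrossing R κ ρ δ` of the conformal rectangle `R` (an open path of
`√2·ℤ²` at mesh `δ` whose closed `ρ`-balls stay in the enlarged domain `Ω ∪ collar₀ ∪ collar₂`, from a vertex
whose ball lies in `collar₀ ∖ Ω` to one whose ball lies in `collar₂ ∖ Ω`), Kesten's covering configuration
`coverMap η` of Beffara's centred square lattice `G_s` (type-I site open iff its `ℤ²`-edge is open, odd face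
centres open, even ones closed) lies in the crude SITE crossing event `crossS (R + δw) δ` of the TRANSLATED
rectangle `R + δ w`, as soon as `0 < δ ≤ κ` and `δ (‖w‖ + 1) ≤ ρ`.

THE PROOF (run extraction at the `G_s` level).  The open bond walk `y₀ — y₁ — ⋯` lifts to the walk
`inr (coverFace y₀) — inl (site of y₀y₁) — inr (coverFace y₁) — ⋯` of OPEN sites of `G_s`
(`cover_exists_lift_walk`; centres sit exactly on the vertices, type-I sites at distance `√2/2` from them,
frame `coverZ = zS`).  Drawing the open-site graph by `P s = δ·coverZ s − δ w` (edges of length `≤ δ ≤ κ`,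
`cover_dist_coverZ_le_one`), every vertex of the lifted walk is within `δ(√2/2 + ‖w‖) ≤ ρ` of a scaled bond
vertex, so the walk is drawn in the enlarged domain and its ends in the exterior collars; the tree's geometric
run extraction `Freeze.exists_crossing_run` yields a sub-walk drawn in `Ω` from within `δ` of `arc 0` to within
`δ` of `arc 2`.  Translating by `δ w` (an isometry) puts it in the window `{δ·zS ∈ Ω + δw}` with the `2δ`
endpoint slack of `crossS`.

References: V. Beffara, *Is critical 2D percolation universal?*, Progr. Probab. 60 (2008) §5.1
[Beffara2008Universal]; H. Kesten, *Percolation theory for mathematicians* (1982) §3.4 [Kesten1982].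
-/

noncomputable section

namespace Summit.CriticalPhenomena.CardyFormulaZ2.Cruxes.CoveringLeg.FiveArmNull

open Literature.Probability.LatticeModels
open Literature.Probability.Percolation
open Literature.Probability.RandomPlanarGeometry
open Literature.Barriers.CriticalPhenomena (MixedSite mixedParam)
open Summit.CriticalPhenomena.CardyFormulaZ2.Theorems.CornerLineDescent.SymmetricSeed

/-! ### Edge lengths of `G_s` in the covering-adapted frame -/

/-- Two points of `ℤ[i]/√2` whose numerators differ by at most `1` in each coordinate are at distance `≤ 1`.
[folklore] -/
theorem cover_dist_div_sqrt_two_le_one {a₁ a₂ b₁ b₂ : ℤ} (h₁ : a₁ - b₁ ≤ 1) (h₁' : b₁ - a₁ ≤ 1)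
    (h₂ : a₂ - b₂ ≤ 1) (h₂' : b₂ - a₂ ≤ 1) :
    dist (((a₁ : ℂ) + (a₂ : ℂ) * Complex.I) / (Real.sqrt 2 : ℂ))
      (((b₁ : ℂ) + (b₂ : ℂ) * Complex.I) / (Real.sqrt 2 : ℂ)) ≤ 1 := by
  rw [Complex.dist_eq, ← sub_div, norm_div, Complex.norm_real, Real.norm_of_nonneg (Real.sqrt_nonneg 2),
    div_le_one (Real.sqrt_pos.2 two_pos)]
  have hre : (a₁ : ℂ) + (a₂ : ℂ) * Complex.I - ((b₁ : ℂ) + (b₂ : ℂ) * Complex.I) =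
      (((a₁ - b₁ : ℤ) : ℝ) : ℂ) + (((a₂ - b₂ : ℤ) : ℝ) : ℂ) * Complex.I := by
    push_cast; ring
  rw [hre, Complex.norm_add_mul_I]
  refine Real.sqrt_le_sqrt ?_
  have i₁ : (a₁ - b₁) ^ 2 ≤ 1 := by nlinarith [mul_nonneg (sub_nonneg.2 h₁) (sub_nonneg.2 h₁')]
  have i₂ : (a₂ - b₂) ^ 2 ≤ 1 := by nlinarith [mul_nonneg (sub_nonneg.2 h₂) (sub_nonneg.2 h₂')]
  have h12 : (a₁ - b₁) ^ 2 + (a₂ - b₂) ^ 2 ≤ 2 := by linarith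
  exact_mod_cast h12

/-- **Edges of `G_s` have length `≤ 1` in the frame `coverZ`** (`ℤ²`-edges: exactly `1`; centre–corner edges:
`√2/2`). [cite: Beffara2008Universal, §5.1] -/
theorem cover_dist_coverZ_le_one {a b : MixedSite} (h : centredSquareGraph.Adj a b) :
    dist (coverZ a) (coverZ b) ≤ 1 := by
  cases a with
  | inl x =>
    cases b with
    | inl y =>
      rw [cover_adj_inl_inl_iff] at h
      obtain ⟨x₁, x₂⟩ := x
      obtain ⟨y₁, y₂⟩ := y
      simp only [Prod.mk.injEq] at h
      simp only [coverZ, Sum.elim_inl]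
      exact cover_dist_div_sqrt_two_le_one (by omega) (by omega) (by omega) (by omega)
    | inr f =>
      rw [centredSquareGraph_adj_inl_inr_iff] at h
      obtain ⟨x₁, x₂⟩ := x
      obtain ⟨f₁, f₂⟩ := f
      simp only at h
      simp only [coverZ, Sum.elim_inl, Sum.elim_inr]
      exact cover_dist_div_sqrt_two_le_one (by omega) (by omega) (by omega) (by omega)
  | inr f =>
    cases b with
    | inl x =>
      have h' := h.symm
      rw [centredSquareGraph_adj_inl_inr_iff] at h'
      obtain ⟨x₁, x₂⟩ := x
      obtain ⟨f₁, f₂⟩ := f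
      simp only at h'
      simp only [coverZ, Sum.elim_inl, Sum.elim_inr]
      exact cover_dist_div_sqrt_two_le_one (by omega) (by omega) (by omega) (by omega)
    | inr g => exact absurd h (not_centredSquareGraph_adj_inr_inr f g)

/-- At mesh `δ`, after the translation by `-δ w`, adjacent sites of `G_s` are drawn at distance `≤ δ`.
[cite: Beffara2008Universal, §5.1] -/
theorem cover_dist_shift_le {δ : ℝ} (hδ : 0 < δ) (w : ℂ) {a b : MixedSite} (h : centredSquareGraph.Adj a b) :
    dist ((δ : ℂ) * coverZ a - (δ : ℂ) * w) ((δ : ℂ) * coverZ b - (δ : ℂ) * w) ≤ δ := by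
  rw [dist_sub_right, dist_eq_norm, ← mul_sub, norm_mul, Complex.norm_real, Real.norm_of_nonneg hδ.le,
    ← dist_eq_norm]
  calc δ * dist (coverZ a) (coverZ b) ≤ δ * 1 := mul_le_mul_of_nonneg_left (cover_dist_coverZ_le_one h) hδ.le
    _ = δ := mul_one δ

/-- The translated scaled point `δ m - δ w` lies in the closed `ρ`-ball about `δ c` as soon as `dist m c ≤ 1` and
`δ (‖w‖ + 1) ≤ ρ`. [folklore] -/
theorem cover_shift_mem_closedBall {δ ρ : ℝ} (hδ : 0 < δ) {w : ℂ} (hρ : δ * (‖w‖ + 1) ≤ ρ) {m c : ℂ}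
    (hd : dist m c ≤ 1) : (δ : ℂ) * m - (δ : ℂ) * w ∈ Metric.closedBall ((δ : ℂ) * c) ρ := by
  rw [Metric.mem_closedBall, dist_eq_norm]
  have : (δ : ℂ) * m - (δ : ℂ) * w - (δ : ℂ) * c = (δ : ℂ) * ((m - c) - w) := by ring
  rw [this, norm_mul, Complex.norm_real, Real.norm_of_nonneg hδ.le]
  rw [dist_eq_norm] at hd
  calc δ * ‖m - c - w‖ ≤ δ * (‖m - c‖ + ‖w‖) := mul_le_mul_of_nonneg_left (norm_sub_le _ _) hδ.le
    _ ≤ δ * (‖w‖ + 1) := mul_le_mul_of_nonneg_left (by linarith) hδ.le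
    _ ≤ ρ := hρ

/-! ### Lifting an open bond walk of `ℤ²` to a walk of open sites of `G_s` -/

/-- The type-III centre attached to a vertex of `ℤ²` is open in every covering configuration.
[cite: Beffara2008Universal, §5.1] -/
theorem cover_coverFace_mem (η : Set (Sym2 (Site 2))) (y : Site 2) :
    (Sum.inr (coverFace y) : MixedSite) ∈ coverMap η :=
  (cover_inr_mem_coverMap_iff η _).2 (cover_not_even_coverFace y)

/-- **One lifted step.** An open lattice edge `y — y + eᵢ` gives the two-edge walk
`inr (coverFace y) — inl (coverSite y i) — inr (coverFace (y + eᵢ))` in the graph induced by `G_s` on the open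
sites of the covering configuration; its three vertices are drawn within `√2/2` of `z y` or of `z (y + eᵢ)`.
[cite: Kesten1982, §3.4] -/
theorem cover_exists_step_walk {η : Set (Sym2 (Site 2))} {y : Site 2} {i : Fin 2}
    (he : s(y, y + Pi.single i 1) ∈ η) :
    ∃ q : (centredSquareGraph.induce (coverMap η)).Walk ⟨Sum.inr (coverFace y), cover_coverFace_mem η y⟩
        ⟨Sum.inr (coverFace (y + Pi.single i 1)), cover_coverFace_mem η _⟩,
      ∀ s ∈ q.support, dist (coverZ s.1) (squareLatticeEmbedding.z y) ≤ Real.sqrt 2 / 2 ∨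
        dist (coverZ s.1) (squareLatticeEmbedding.z (y + Pi.single i 1)) ≤ Real.sqrt 2 / 2 := by
  have hmo : (Sum.inl (coverSite y i) : MixedSite) ∈ coverMap η := by
    rw [cover_inl_mem_coverMap_iff, coverEdge_coverSite]; exact he
  have h1 : (centredSquareGraph.induce (coverMap η)).Adj ⟨Sum.inr (coverFace y), cover_coverFace_mem η y⟩
      ⟨Sum.inl (coverSite y i), hmo⟩ :=
    SimpleGraph.induce_adj.2 (cover_adj_coverSite_coverFace y i).symm
  have h2 : (centredSquareGraph.induce (coverMap η)).Adj ⟨Sum.inl (coverSite y i), hmo⟩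
      ⟨Sum.inr (coverFace (y + Pi.single i 1)), cover_coverFace_mem η _⟩ :=
    SimpleGraph.induce_adj.2 (cover_adj_coverSite_coverFace_add y i)
  have h0 : (0 : ℝ) ≤ Real.sqrt 2 / 2 := by positivity
  refine ⟨SimpleGraph.Walk.cons h1 (SimpleGraph.Walk.cons h2 SimpleGraph.Walk.nil), fun s hs => ?_⟩
  rw [SimpleGraph.Walk.support_cons, SimpleGraph.Walk.support_cons, SimpleGraph.Walk.support_nil,
    List.mem_cons, List.mem_cons, List.mem_singleton] at hs
  rcases hs with rfl | rfl | rfl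
  · left
    show dist (coverZ (Sum.inr (coverFace y))) _ ≤ _
    rw [cover_coverZ_inr_coverFace, dist_self]; exact h0
  · left; exact (cover_dist_coverSite y i).le
  · right
    show dist (coverZ (Sum.inr (coverFace (y + Pi.single i 1)))) _ ≤ _
    rw [cover_coverZ_inr_coverFace, dist_self]; exact h0

/-- **Lifting an open bond walk** (Kesten's covering correspondence, for a lattice configuration
`η ⊆ E(ℤ²)`): an open walk `x — ⋯ — y` of `ℤ²` lifts to a walk from `inr (coverFace x)` to `inr (coverFace y)` in
the graph induced by `G_s` on the OPEN sites of `coverMap η`, every vertex of which is drawn (frame `coverZ`) within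
`√2/2` of some vertex of the bond walk (frame `squareLatticeEmbedding.z`). [cite: Kesten1982, §3.4] -/
theorem cover_exists_lift_walk {η : Set (Sym2 (Site 2))} (hη : η ⊆ (zdGraph 2).edgeSet) {x y : Site 2}
    (p : (openGraph η).Walk x y) :
    ∃ q : (centredSquareGraph.induce (coverMap η)).Walk ⟨Sum.inr (coverFace x), cover_coverFace_mem η x⟩
        ⟨Sum.inr (coverFace y), cover_coverFace_mem η y⟩,
      ∀ s ∈ q.support, ∃ x' ∈ p.support, dist (coverZ s.1) (squareLatticeEmbedding.z x') ≤ Real.sqrt 2 / 2 := by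
  induction p with
  | @nil x =>
    refine ⟨SimpleGraph.Walk.nil, fun s hs => ⟨x, by simp, ?_⟩⟩
    rw [SimpleGraph.Walk.support_nil, List.mem_singleton] at hs
    rw [hs]
    show dist (coverZ (Sum.inr (coverFace x))) _ ≤ _
    rw [cover_coverZ_inr_coverFace, dist_self]
    positivity
  | @cons x x₁ y h p ih =>
    obtain ⟨q, hq⟩ := ih
    have h' := (openGraph_adj η x x₁).1 h
    have hadj : (zdGraph 2).Adj x x₁ := by
      have := hη h'.1
      rwa [SimpleGraph.mem_edgeSet] at this
    obtain ⟨i, hi | hi⟩ := (zdGraph_adj_iff x x₁).1 hadj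
    · subst hi
      obtain ⟨q₁, hq₁⟩ := cover_exists_step_walk (η := η) (y := x) (i := i) h'.1
      refine ⟨q₁.append q, fun s hs => ?_⟩
      rw [SimpleGraph.Walk.mem_support_append_iff] at hs
      rcases hs with hs | hs
      · rcases hq₁ s hs with hd | hd
        · exact ⟨x, by simp, hd⟩
        · exact ⟨x + Pi.single i 1, by simp, hd⟩
      · obtain ⟨x', hx', hd⟩ := hq s hs
        exact ⟨x', by simp [hx'], hd⟩
    · subst hi
      obtain ⟨q₁, hq₁⟩ := cover_exists_step_walk (η := η) (y := x₁) (i := i) (by rw [Sym2.eq_swap]; exact h'.1)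
      refine ⟨q₁.reverse.append q, fun s hs => ?_⟩
      rw [SimpleGraph.Walk.mem_support_append_iff, SimpleGraph.Walk.support_reverse, List.mem_reverse] at hs
      rcases hs with hs | hs
      · rcases hq₁ s hs with hd | hd
        · exact ⟨x₁, by simp, hd⟩
        · exact ⟨x₁ + Pi.single i 1, by simp, hd⟩
      · obtain ⟨x', hx', hd⟩ := hq s hs
        exact ⟨x', by simp [hx'], hd⟩

/-! ### The lower inclusion for the shifted family -/

/-- **Registered helper stub `cover_lowerCrossing_subset_crossS_shift` of `stub_coveringBridgeShift`
(skeleton v3, line `five-arm-null`).**  For `0 < δ ≤ κ`, `δ (‖w‖ + 1) ≤ ρ` and a lattice configuration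
`η ⊆ E(ℤ²)`: if `η` lies in the thinned collar-to-collar crude bond crossing event `Freeze.lowerCrossing R κ ρ δ`
of `R`, then Kesten's covering configuration `coverMap η` lies in the crude site crossing event
`crossS (R + δ w) δ` of the translated rectangle `R + δw` on `G_s` (frame `zS`).  Proof: lift the open bond walk
to a walk of open sites of `G_s` (`cover_exists_lift_walk`), draw it by `s ↦ δ·coverZ s − δ w` (edges `≤ δ`,
vertices within `ρ` of the scaled bond vertices, hence inside the enlarged domain with ends in the exterior
collars), extract the run inside `Ω` (`Freeze.exists_crossing_run`) and translate back by the isometry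
`· + δ w`. [cite: Beffara2008Universal, §5.1] -/
theorem cover_lowerCrossing_subset_crossS_shift : ∀ (R : Literature.Probability.RandomPlanarGeometry.ConformalRectangle) (w : ℂ) (κ ρ δ : ℝ), 0 < δ → δ ≤ κ → δ * (‖w‖ + 1) ≤ ρ → ∀ (η : Set (Sym2 (Literature.Probability.LatticeModels.Site 2))), η ⊆ (Literature.Probability.LatticeModels.zdGraph 2).edgeSet → η ∈ Summit.CriticalPhenomena.CardyFormulaZ2.Theorems.CornerLineDescent.SymmetricSeed.Freeze.lowerCrossing R κ ρ δ → Summit.CriticalPhenomena.CardyFormulaZ2.Cruxes.CoveringLeg.FiveArmNull.coverMap η ∈ Summit.CriticalPhenomena.CardyFormulaZ2.Cruxes.CoveringLeg.FiveArmNull.crossS (R.map (Literature.Probability.RandomPlanarGeometry.similarity 1 one_ne_zero ((δ : ℂ) * w))) δ := by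
  intro R w κ ρ δ hδ hκ hρ η hη h
  obtain ⟨u₀, hu₀, v₀, hv₀, huv⟩ := h
  rw [mem_openConnIn_iff_exists_openWalk] at huv
  obtain ⟨p₀, hp₀⟩ := huv
  obtain ⟨q₀, hq₀⟩ := cover_exists_lift_walk hη p₀
  -- positions of the open sites: the covering frame at mesh `δ`, translated by `-δ w`
  set P : coverMap η → ℂ := fun s => (δ : ℂ) * coverZ s.1 - (δ : ℂ) * w with hP
  have hstep : ∀ a b, (centredSquareGraph.induce (coverMap η)).Adj a b → dist (P a) (P b) ≤ δ :=
    fun a b hab => cover_dist_shift_le hδ w (SimpleGraph.induce_adj.1 hab)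
  have hend : ∀ y : Site 2, P ⟨Sum.inr (coverFace y), cover_coverFace_mem η y⟩ ∈
      Metric.closedBall ((δ : ℂ) * squareLatticeEmbedding.z y) ρ := fun y => by
    show (δ : ℂ) * coverZ (Sum.inr (coverFace y)) - (δ : ℂ) * w ∈ _
    rw [cover_coverZ_inr_coverFace]
    exact cover_shift_mem_closedBall hδ hρ (by rw [dist_self]; exact zero_le_one)
  have hsupp : ∀ s ∈ q₀.support, P s ∈ Freeze.enlarge R κ := fun s hs => by
    obtain ⟨x', hx', hd⟩ := hq₀ s hs
    exact hp₀ x' hx' (cover_shift_mem_closedBall hδ hρ (hd.trans cover_sqrt_two_div_two_lt_one.le))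
  obtain ⟨a, b, q, hq, ha, hb⟩ :=
    Freeze.exists_crossing_run P hκ hstep R q₀ (hu₀ (hend u₀)) (hv₀ (hend v₀)) hsupp
  -- translating back by `δ w`
  have hΦ : Isometry (similarity 1 one_ne_zero ((δ : ℂ) * w)) :=
    Isometry.of_dist_eq fun p q => by simp only [similarity_apply, one_mul, dist_add_right]
  have hPΦ : ∀ s, similarity 1 one_ne_zero ((δ : ℂ) * w) (P s) = (δ : ℂ) * zS s.1 := fun s => by
    rw [similarity_apply, one_mul]
    show (δ : ℂ) * coverZ s.1 - (δ : ℂ) * w + (δ : ℂ) * w = (δ : ℂ) * coverZ s.1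
    exact sub_add_cancel _ _
  rw [crossS_eq, mem_siteEmbDomainCrossing_iff]
  refine ⟨a.1, b.1, ?_, ?_, ?_⟩
  · rw [MarkedDomain.arc_map, ← hPΦ a, Metric.infDist_image hΦ]; linarith
  · rw [MarkedDomain.arc_map, ← hPΦ b, Metric.infDist_image hΦ]; linarith
  · rw [gsGraph_eq]
    refine ⟨a.2, b.2, ?_⟩
    rw [exists_reachable_induce_iff_exists_walk]
    refine ⟨q.map
      { toFun := Subtype.val
        map_rel' := fun {s t} hst =>
          (siteOpenGraph_adj _ _ _ _).2 ⟨SimpleGraph.induce_adj.1 hst, s.2, t.2⟩ }, fun s hs => ?_⟩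
    rw [SimpleGraph.Walk.support_map, List.mem_map] at hs
    obtain ⟨s', hs', rfl⟩ := hs
    show (δ : ℂ) * zS s'.1 ∈ (R.map (similarity 1 one_ne_zero ((δ : ℂ) * w))).carrier
    rw [MarkedDomain.carrier_map, ← hPΦ s']
    exact Set.mem_image_of_mem _ (hq s' hs')

end Summit.CriticalPhenomena.CardyFormulaZ2.Cruxes.CoveringLeg.FiveArmNull

end
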